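import Summits.ValiantsHypothesis.ValiantsHypothesis.Theorems.BarrierLeverAnchoredDoorHitsLowerPairsIsoPairs
import Summits.ValiantsHypothesis.ValiantsHypothesis.Theorems.BarrierLeverAnchoredDoorHitsLowerPairsThinStepKill
import Summits.ValiantsHypothesis.ValiantsHypothesis.Theorems.BarrierLeverAnchoredDoorHitsLowerPairsUQFaceSpec

/-!
# Support item `AnchoredDoorHitsLowerPairs` (stmt-ValiantsHypothesis-22510), line `anchored-peeling`:
# THE TOTAL MULTI-PEEL MEMBER of 𝔄₁ and its layout (toward the kernel reduction «Conjecture L ⟹ cube versus complexes on n+1 vertices»)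

Helper file (`--supports stmt-ValiantsHypothesis-22510`; cell valiant-natproofs, rung V4, 𝒟-side door (c); registered line
`Cruxes/AnchoredDoorHitsLowerPairs/Lines/anchored_peeling.lean` v14; prover seat val-np-p1 gen 20; memo HOME/val-np-p1/g19/PEEL-HALL-valnp1-g19.md §20).
Closes NO item.

The residual of the face-target UQ step (`stub_uqFaceStep`, p626525) at a fixed profile contains the pairs «cube `2^X` versus a lower family on
`|X| + 1` vertices `Γ ⊔ {c₀}`» (branch (i), memo §19). The TOTAL MULTI-PEEL (memo §20) is the member of 𝔄₁ obtained at the parameter point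
`multiPeelPoint Γ π c₀ θ φ`: every `y`-vertex `γ ∈ Γ` keeps only the bare anchor `(π γ | γ)` with weight `1`, the target vertex `c₀` keeps its
anchors `(b | c₀)` with weights `θ b` and `x`-tails `φ b ·`, every other parameter is `0`. The member is
`D_spec = (∏_b (1 + θ_b x_b y_{c₀} ∏_{b'≠b}(1 + φ_{bb'} x_{b'}))) · ∏_{γ∈Γ} (1 + x_{πγ} y_γ)` (`map_multiPeelPoint_symbolicWitness`) and its layout entries are
(`coeff_multiPeel`) `[x^U y^W] D_spec = [π(W∖c₀) ⊆ U] · ( [c₀ ∈ W] · g(U ∖ π(W∖c₀)) + [c₀ ∉ W] · [U = πW] )` for `W ⊆ Γ ∪ {c₀}`, with the door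
coefficient `g(V) = Σ_{b∈V} θ_b ∏_{b'∈V∖b} φ_{bb'}` (`doorCoeffX`). The sequel `…ConjLReduction` turns this into
`Stmt.stub_conjL → symbolicDet 1 (cube, C) ≠ 0`.

WHAT THIS IS NOT: no determinant statement (sequel); nothing on crux stmt-ValiantsHypothesis-14610 or on `VP` versus `VNP`.
-/

set_option linter.dupNamespace false

namespace Summit.ValiantsHypothesis.ValiantsHypothesis.Theorems.BarrierLever.AnchoredPeeling

open Finset MvPolynomial
open Summit.ValiantsHypothesis.ValiantsHypothesis.Theorems.BarrierLever.BrickCalculus (pexpo pexpo_def pexpo_le_iff pexpo_sub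
  pexpo_apply_natAdd pexpo_apply_castAdd brick brick_eq coeff_pexpo_mul_brick)

noncomputable section

variable {h : ℕ}

/-! ## 1. The `c₀`-part -/

/-- The door coefficient on `x`-faces: `g(V) = Σ_{b ∈ V} θ_b ∏_{b' ∈ V ∖ b} φ_{b b'}`. -/
def doorCoeffX (θ : Fin h → ℂ) (φ : Fin h → Fin h → ℂ) (V : Finset (Fin h)) : ℂ :=
  ∑ b ∈ V, θ b * ∏ b' ∈ V.erase b, φ b b'

/-- The `x`-core of the anchor `(b | c₀)` at the multi-peel point: `x_b · θ_b · ∏_{b'≠b} (1 + φ_{bb'} x_{b'})`. -/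
def cfacCore (θ : Fin h → ℂ) (φ : Fin h → Fin h → ℂ) (b : Fin h) : MvPolynomial (Fin (h + h)) ℂ :=
  monomial (pexpo {b} ∅) 1 * (C (θ b) * ∏ b' ∈ univ \ {b}, (1 + C (φ b b') * X (Fin.castAdd h b')))

/-- The factor of the anchor `(b | c₀)` at the multi-peel point: `1 + y_{c₀} · cfacCore b`. -/
def cfac (θ : Fin h → ℂ) (φ : Fin h → Fin h → ℂ) (c₀ b : Fin h) : MvPolynomial (Fin (h + h)) ℂ :=
  1 + monomial (pexpo ∅ {c₀}) 1 * cfacCore θ φ b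

/-- The `c₀`-part of the multi-peel member. -/
def cpart (θ : Fin h → ℂ) (φ : Fin h → Fin h → ℂ) (c₀ : Fin h) : MvPolynomial (Fin (h + h)) ℂ :=
  ∏ b, cfac θ φ c₀ b

/-- `[x^V] cfacCore b = [b ∈ V] · θ_b ∏_{b' ∈ V∖b} φ_{bb'}`. -/
theorem coeff_cfacCore (θ : Fin h → ℂ) (φ : Fin h → Fin h → ℂ) (b : Fin h) (V : Finset (Fin h)) :
    coeff (pexpo V ∅) (cfacCore θ φ b) = if b ∈ V then θ b * ∏ b' ∈ V.erase b, φ b b' else 0 := by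
  classical
  rw [cfacCore, ProductRule.prod_one_add_C_mul_X_fun, Finset.mul_sum, Finset.mul_sum, coeff_sum]
  have hterm : ∀ Z ∈ (univ \ {b} : Finset (Fin h)).powerset,
      coeff (pexpo V ∅) (monomial (pexpo {b} ∅) (1 : ℂ) * (C (θ b) * monomial (∑ d ∈ Z, Finsupp.single (Fin.castAdd h d) 1) (∏ d ∈ Z, φ b d))) =
        if insert b Z = V then θ b * ∏ d ∈ Z, φ b d else 0 := by
    intro Z hZ
    have hbZ : b ∉ Z := fun hb => by simpa using Finset.mem_powerset.mp hZ hb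
    have hpe : (∑ d ∈ Z, Finsupp.single (Fin.castAdd h d) 1 : Fin (h + h) →₀ ℕ) = pexpo Z ∅ := by
      rw [pexpo_def, Finset.sum_empty, add_zero]
    rw [hpe, C_mul_monomial, monomial_mul, one_mul, ← pexpo_union (Finset.disjoint_singleton_left.mpr hbZ) (Finset.disjoint_empty_left _),
      Finset.empty_union, coeff_monomial, ← Finset.insert_eq]
    by_cases hV : insert b Z = V
    · rw [if_pos (by rw [hV]), if_pos hV]
    · rw [if_neg (fun heq => hV (DistinctAnchors.pexpo_inj heq).1), if_neg hV]
  rw [Finset.sum_congr rfl hterm]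
  by_cases hb : b ∈ V
  · rw [if_pos hb, Finset.sum_eq_single (V.erase b)]
    · rw [if_pos (Finset.insert_erase hb)]
    · intro Z hZ hne
      rw [if_neg]
      intro heq
      apply hne
      rw [← heq, Finset.erase_insert]
      exact fun hbZ => by simpa using Finset.mem_powerset.mp hZ hbZ
    · exact fun hne => absurd (Finset.mem_powerset.mpr (fun x hx => Finset.mem_sdiff.mpr
        ⟨Finset.mem_univ _, fun hxb => (Finset.mem_erase.mp hx).1 (Finset.mem_singleton.mp hxb)⟩)) hne
  · rw [if_neg hb]
    exact Finset.sum_eq_zero (fun Z _ => by rw [if_neg]; exact fun heq => hb (heq ▸ Finset.mem_insert_self b Z))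

/-- Killing a `y`-variable other than `y_{c₀}` does not change the `c₀`-part. -/
theorem killVars_cpart (θ : Fin h → ℂ) (φ : Fin h → Fin h → ℂ) (c₀ d : Fin h) (hd : d ≠ c₀) :
    ThinStep.killVars {Fin.natAdd h d} (cpart θ φ c₀) = cpart θ φ c₀ := by
  classical
  rw [cpart, map_prod]
  refine Finset.prod_congr rfl (fun b _ => ?_)
  have hne1 : Fin.natAdd h c₀ ≠ Fin.natAdd h d := fun heq => hd (Fin.natAdd_inj _ |>.mp heq).symm
  have hne2 : ∀ b' : Fin h, Fin.castAdd h b' ≠ Fin.natAdd h d := fun b' heq => by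
    have := congrArg Fin.val heq
    simp only [Fin.val_castAdd, Fin.val_natAdd] at this
    have := b'.isLt; omega
  have hm1 : Disjoint (pexpo (∅ : Finset (Fin h)) {c₀}).support {Fin.natAdd h d} := by
    rw [Finset.disjoint_singleton_right, Finsupp.mem_support_iff, not_not, pexpo_def, Finset.sum_empty, zero_add,
      Finset.sum_singleton, Finsupp.single_apply, if_neg hne1]
  have hm2 : Disjoint (pexpo ({b} : Finset (Fin h)) ∅).support {Fin.natAdd h d} := by
    rw [Finset.disjoint_singleton_right, Finsupp.mem_support_iff, not_not, pexpo_def, Finset.sum_empty, add_zero,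
      Finset.sum_singleton, Finsupp.single_apply, if_neg (hne2 b)]
  have htw : ∀ b' : Fin h, ThinStep.killVars {Fin.natAdd h d} (1 + C (φ b b') * X (Fin.castAdd h b') : MvPolynomial (Fin (h + h)) ℂ) =
      1 + C (φ b b') * X (Fin.castAdd h b') := fun b' => by
    rw [map_add, map_one, map_mul, ThinStep.killVars_C, ThinStep.killVars_X, if_neg (fun hmem => hne2 b' (Finset.mem_singleton.mp hmem))]
  rw [cfac, cfacCore, map_add, map_one, map_mul, map_mul, map_mul, ThinStep.killVars_monomial, if_pos hm1, ThinStep.killVars_monomial,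
    if_pos hm2, ThinStep.killVars_C, map_prod, Finset.prod_congr rfl (fun b' _ => htw b')]

/-- **Coefficients of the `c₀`-part**: `[x^V y^T] cpart = [T = ∅][V = ∅] + [T = {c₀}] g(V)`. -/
theorem coeff_cpart (θ : Fin h → ℂ) (φ : Fin h → Fin h → ℂ) (c₀ : Fin h) (V T : Finset (Fin h)) :
    coeff (pexpo V T) (cpart θ φ c₀) =
      if T = ∅ then (if V = ∅ then 1 else 0) else if T = {c₀} then doorCoeffX θ φ V else 0 := by
  classical
  obtain ⟨Rm, hRm⟩ := prod_one_add_monomial_mul (Finset.univ : Finset (Fin h)) (pexpo (∅ : Finset (Fin h)) {c₀}) (cfacCore θ φ)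
  have hcp : cpart θ φ c₀ = 1 + ∑ b, monomial (pexpo (∅ : Finset (Fin h)) {c₀}) 1 * cfacCore θ φ b +
      monomial (pexpo (∅ : Finset (Fin h)) {c₀} + pexpo (∅ : Finset (Fin h)) {c₀}) 1 * Rm := by
    rw [cpart]; exact hRm
  by_cases hT0 : T = ∅
  · subst hT0
    rw [if_pos rfl, hcp, coeff_add, coeff_add, coeff_sum]
    have h1 : coeff (pexpo V ∅) (1 : MvPolynomial (Fin (h + h)) ℂ) = if V = ∅ then 1 else 0 := by
      rw [← C_1, coeff_C]
      by_cases hV : V = ∅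
      · rw [if_pos hV, hV, if_pos ProductRule.pexpo_empty_empty.symm]
      · rw [if_neg hV, if_neg]
        intro h0
        have : pexpo (∅ : Finset (Fin h)) ∅ = pexpo V ∅ := by rw [ProductRule.pexpo_empty_empty]; exact h0
        exact hV (DistinctAnchors.pexpo_inj this).1.symm
    have hno : ¬ pexpo (∅ : Finset (Fin h)) {c₀} ≤ pexpo V ∅ := fun hle =>
      Finset.notMem_empty c₀ (((pexpo_le_iff _ _ _ _).mp hle).2 (Finset.mem_singleton_self c₀))
    have h2 : ∀ b, coeff (pexpo V ∅) (monomial (pexpo (∅ : Finset (Fin h)) {c₀}) (1 : ℂ) * cfacCore θ φ b) = 0 := fun b => by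
      rw [coeff_monomial_mul', if_neg hno]
    have h3 : coeff (pexpo V ∅) (monomial (pexpo (∅ : Finset (Fin h)) {c₀} + pexpo (∅ : Finset (Fin h)) {c₀}) (1 : ℂ) * Rm) = 0 := by
      rw [coeff_monomial_mul', if_neg]
      intro hle
      exact hno (le_trans le_self_add hle)
    rw [h1, Finset.sum_eq_zero (fun b _ => h2 b), h3, add_zero, add_zero]
  rw [if_neg hT0]
  by_cases hTc : T = {c₀}
  · subst hTc
    rw [if_pos rfl, hcp, coeff_add, coeff_add, coeff_sum]
    have h1 : coeff (pexpo V {c₀}) (1 : MvPolynomial (Fin (h + h)) ℂ) = 0 := by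
      rw [← C_1, coeff_C, if_neg]
      intro h0
      have : pexpo (∅ : Finset (Fin h)) ∅ = pexpo V {c₀} := by rw [ProductRule.pexpo_empty_empty]; exact h0
      exact Finset.singleton_ne_empty c₀ (DistinctAnchors.pexpo_inj this).2.symm
    have hle : pexpo (∅ : Finset (Fin h)) {c₀} ≤ pexpo V {c₀} := (pexpo_le_iff _ _ _ _).mpr ⟨Finset.empty_subset _, subset_rfl⟩
    have h2 : ∀ b, coeff (pexpo V {c₀}) (monomial (pexpo (∅ : Finset (Fin h)) {c₀}) (1 : ℂ) * cfacCore θ φ b) =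
        if b ∈ V then θ b * ∏ b' ∈ V.erase b, φ b b' else 0 := fun b => by
      rw [coeff_monomial_mul', if_pos hle, one_mul, pexpo_sub _ _ _ _ (Finset.empty_subset _) subset_rfl, Finset.sdiff_empty,
        Finset.sdiff_self, coeff_cfacCore]
    have h3 : coeff (pexpo V {c₀}) (monomial (pexpo (∅ : Finset (Fin h)) {c₀} + pexpo (∅ : Finset (Fin h)) {c₀}) (1 : ℂ) * Rm) = 0 := by
      rw [coeff_monomial_mul', if_neg]
      intro hle2
      have := Finsupp.le_def.mp hle2 (Fin.natAdd h c₀)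
      simp only [Finsupp.coe_add, Pi.add_apply, pexpo_apply_natAdd, Finset.mem_singleton, if_true] at this
      omega
    rw [h1, zero_add, Finset.sum_congr rfl (fun b _ => h2 b), h3, add_zero, doorCoeffX, ← Finset.sum_filter]
    refine Finset.sum_congr (by ext b; simp) (fun b _ => rfl)
  · rw [if_neg hTc]
    -- some `d ∈ T` differs from `c₀`; killing `y_d` fixes the `c₀`-part but kills the coefficient
    obtain ⟨d, hdT, hdc⟩ : ∃ d ∈ T, d ≠ c₀ := by
      by_contra hno
      push Not at hno
      rcases Finset.eq_empty_or_nonempty T with hT | ⟨d, hd⟩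
      · exact hT0 hT
      · apply hTc
        ext x
        rw [Finset.mem_singleton]
        exact ⟨fun hx => hno x hx, fun hx => hx ▸ (hno d hd ▸ hd)⟩
    rw [← killVars_cpart θ φ c₀ d hdc]
    refine ThinStep.coeff_killVars_of_not_disjoint _ _ (fun hdis => ?_)
    have hmem : Fin.natAdd h d ∈ (pexpo V T).support := by
      rw [Finsupp.mem_support_iff, pexpo_apply_natAdd, if_pos hdT]; exact one_ne_zero
    exact (Finset.disjoint_right.mp hdis (Finset.mem_singleton_self _)) hmem

/-! ## 2. Reading a product of vertex bricks -/

/-- `U \ insert x A = (U \ {x}) \ A`. -/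
private theorem sdiff_insert_eq (U A : Finset (Fin h)) (x : Fin h) : U \ insert x A = (U \ {x}) \ A := by
  ext y
  simp only [Finset.mem_sdiff, Finset.mem_insert, Finset.mem_singleton]
  tauto

/-- **Reading rule for the bricks `∏_{γ ∈ Γ'} (1 + x_{πγ} y_γ)`**: the bricks used form a subset `S ⊆ Γ' ∩ T` with `π S ⊆ U`, and the rest of the
monomial is read in `f`. -/
theorem coeff_mul_prod_brick (π : Equiv.Perm (Fin h)) (f : MvPolynomial (Fin (h + h)) ℂ) (Γ' : Finset (Fin h)) :
    ∀ U T : Finset (Fin h), coeff (pexpo U T) (f * ∏ γ ∈ Γ', brick {π γ} {γ}) =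
      ∑ S ∈ (Γ' ∩ T).powerset, (if S.image π ⊆ U then coeff (pexpo (U \ S.image π) (T \ S)) f else 0) := by
  classical
  induction Γ' using Finset.induction_on with
  | empty =>
    intro U T
    rw [Finset.prod_empty, mul_one, Finset.empty_inter, Finset.powerset_empty, Finset.sum_singleton, Finset.image_empty,
      if_pos (Finset.empty_subset _), Finset.sdiff_empty, Finset.sdiff_empty]
  | insert γ Γ' hγ ih =>
    intro U T
    have hre : f * ∏ x ∈ insert γ Γ', brick {π x} {x} = (f * ∏ x ∈ Γ', brick {π x} {x}) * brick {π γ} {γ} := by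
      rw [Finset.prod_insert hγ]; ring
    rw [hre, coeff_pexpo_mul_brick, ih]
    by_cases hγT : γ ∈ T
    · have hinter : Γ' ∩ (T \ {γ}) = Γ' ∩ T := by
        ext x
        simp only [Finset.mem_inter, Finset.mem_sdiff, Finset.mem_singleton]
        exact ⟨fun hx => ⟨hx.1, hx.2.1⟩, fun hx => ⟨hx.1, hx.2, fun hxγ => hγ (hxγ ▸ hx.1)⟩⟩
      have hdisj : Disjoint (Γ' ∩ T).powerset (((Γ' ∩ T).powerset).image (insert γ)) := by
        rw [Finset.disjoint_left]
        intro S hS hS'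
        obtain ⟨S', -, rfl⟩ := Finset.mem_image.mp hS'
        have := Finset.mem_powerset.mp hS (Finset.mem_insert_self γ S')
        exact hγ (Finset.mem_inter.mp this).1
      have hnot : ∀ S ∈ (Γ' ∩ T).powerset, γ ∉ S := fun S hS h' => hγ (Finset.mem_inter.mp (Finset.mem_powerset.mp hS h')).1
      rw [Finset.insert_inter_of_mem hγT, Finset.powerset_insert, Finset.sum_union hdisj,
        Finset.sum_image (fun S hS S' hS' heq => by rw [← Finset.erase_insert (hnot S hS), heq, Finset.erase_insert (hnot S' hS')])]
      congr 1
      by_cases hπγ : π γ ∈ U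
      · rw [if_pos ⟨Finset.singleton_subset_iff.mpr hπγ, Finset.singleton_subset_iff.mpr hγT⟩, ih, hinter]
        refine Finset.sum_congr rfl (fun S hS => ?_)
        have hγS : γ ∉ S := hnot S hS
        have hπγS : π γ ∉ S.image π := fun hmem => by
          obtain ⟨x, hx, hxe⟩ := Finset.mem_image.mp hmem
          exact hγS (π.injective hxe ▸ hx)
        rw [Finset.image_insert, sdiff_insert_eq, sdiff_insert_eq]
        by_cases hsub : S.image π ⊆ U
        · have h1 : S.image π ⊆ U \ {π γ} := fun x hx =>
            Finset.mem_sdiff.mpr ⟨hsub hx, fun hxγ => hπγS (by rwa [Finset.mem_singleton.mp hxγ] at hx)⟩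
          rw [if_pos h1, if_pos (Finset.insert_subset hπγ hsub)]
        · have h1 : ¬ S.image π ⊆ U \ {π γ} := fun h' => hsub (fun x hx => (Finset.mem_sdiff.mp (h' hx)).1)
          have h2 : ¬ insert (π γ) (S.image π) ⊆ U := fun h' => hsub ((Finset.subset_insert _ _).trans h')
          rw [if_neg h1, if_neg h2]
      · rw [if_neg (fun h' => hπγ (h'.1 (Finset.mem_singleton_self _)))]
        refine (Finset.sum_eq_zero (fun S _ => ?_)).symm
        rw [if_neg]
        exact fun h' => hπγ (h' (by rw [Finset.image_insert]; exact Finset.mem_insert_self _ _))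
    · rw [if_neg (fun h' => hγT (h'.2 (Finset.mem_singleton_self γ))), add_zero, Finset.insert_inter_of_notMem hγT]

/-! ## 3. The multi-peel point and the specialised member -/

/-- The parameter point of the TOTAL MULTI-PEEL (profile 1): the anchor `(b | c₀)` gets weight `θ b` and `x`-tails `φ b ·`; the anchor `(π γ | γ)`,
`γ ∈ Γ`, gets weight `1` and no tails; everything else is `0`. (Values on anchors of higher profile are irrelevant.) -/
def multiPeelPoint (Γ : Finset (Fin h)) (π : Equiv.Perm (Fin h)) (c₀ : Fin h) (θ : Fin h → ℂ) (φ : Fin h → Fin h → ℂ) : Param h → ℂ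
  | Sum.inl α => if α.2 = {c₀} then ∑ b ∈ α.1, θ b else if ∃ γ ∈ Γ, α = ({π γ}, {γ}) then 1 else 0
  | Sum.inr (Sum.inl (α, b')) => if α.2 = {c₀} then ∑ b ∈ α.1, φ b b' else 0
  | Sum.inr (Sum.inr _) => 0

section Member

variable (Γ : Finset (Fin h)) (π : Equiv.Perm (Fin h)) (c₀ : Fin h) (θ : Fin h → ℂ) (φ : Fin h → Fin h → ℂ)

/-- A factor of the symbolic witness, with the anchor monomial exposed and the tails grouped. -/
private theorem map_eval_symbFactor (p : Param h → ℂ) (α : Finset (Fin h) × Finset (Fin h)) :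
    MvPolynomial.map (eval p) (symbFactor h α) =
      1 + monomial (pexpo α.1 α.2) 1 * (C (p (Sum.inl α)) *
        ((∏ b ∈ univ \ α.1, (1 + C (p (Sum.inr (Sum.inl (α, b)))) * X (Fin.castAdd h b))) *
         (∏ d ∈ univ \ α.2, (1 + C (p (Sum.inr (Sum.inr (α, d)))) * X (Fin.natAdd h d))))) := by
  rw [symbFactor_eq]
  simp only [map_add, map_one, map_mul, map_prod, map_monomial, map_C, map_X, eval_X, _root_.map_one]
  ring

/-- The factor of a profile-1 anchor `({a}, {d})` at the multi-peel point. -/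
theorem map_multiPeelPoint_symbFactor (hc₀ : c₀ ∉ Γ) (a d : Fin h) :
    MvPolynomial.map (eval (multiPeelPoint Γ π c₀ θ φ)) (symbFactor h ({a}, {d})) =
      if d = c₀ then cfac θ φ c₀ a else if (d ∈ Γ ∧ a = π d) then brick {π d} {d} else 1 := by
  classical
  rw [map_eval_symbFactor]
  have hy : ∀ d' : Fin h, (1 + C (multiPeelPoint Γ π c₀ θ φ (Sum.inr (Sum.inr ((({a}, {d}) : Finset (Fin h) × Finset (Fin h)), d')))) *
      X (Fin.natAdd h d') : MvPolynomial (Fin (h + h)) ℂ) = 1 := fun d' => by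
    rw [multiPeelPoint, C_0, zero_mul, add_zero]
  rw [Finset.prod_eq_one (fun d' _ => hy d'), mul_one]
  by_cases hd : d = c₀
  · subst hd
    rw [if_pos rfl, cfac, cfacCore]
    have hθ : multiPeelPoint Γ π d θ φ (Sum.inl ({a}, {d})) = θ a := by
      simp [multiPeelPoint]
    have hφ : ∀ b', multiPeelPoint Γ π d θ φ (Sum.inr (Sum.inl ((({a}, {d}) : Finset (Fin h) × Finset (Fin h)), b'))) = φ a b' := by
      intro b'; simp [multiPeelPoint]
    simp only [hθ, hφ]
    have hmm : (monomial (pexpo (∅ : Finset (Fin h)) {d}) (1 : ℂ) * monomial (pexpo ({a} : Finset (Fin h)) ∅) 1 :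
        MvPolynomial (Fin (h + h)) ℂ) = monomial (pexpo {a} {d}) 1 := by
      rw [monomial_mul, one_mul, ← pexpo_union (Finset.disjoint_empty_left _) (Finset.disjoint_empty_right _), Finset.empty_union,
        Finset.union_empty]
    rw [← mul_assoc (monomial (pexpo (∅ : Finset (Fin h)) {d}) (1 : ℂ)), hmm]
  · rw [if_neg hd]
    have hθ : multiPeelPoint Γ π c₀ θ φ (Sum.inl ({a}, {d})) = if (d ∈ Γ ∧ a = π d) then 1 else 0 := by
      simp only [multiPeelPoint, Finset.singleton_inj, if_neg hd, Prod.mk.injEq]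
      by_cases hda : d ∈ Γ ∧ a = π d
      · rw [if_pos hda, if_pos ⟨d, hda.1, by rw [hda.2], rfl⟩]
      · rw [if_neg hda, if_neg]
        rintro ⟨γ, hγ, h1, h2⟩
        exact hda ⟨h2 ▸ hγ, by rw [h1, h2]⟩
    have hφ : ∀ b', multiPeelPoint Γ π c₀ θ φ (Sum.inr (Sum.inl ((({a}, {d}) : Finset (Fin h) × Finset (Fin h)), b'))) = 0 := by
      intro b'; simp [multiPeelPoint, hd]
    simp only [hφ, C_0, zero_mul, add_zero, Finset.prod_const_one, mul_one, hθ]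
    by_cases hda : d ∈ Γ ∧ a = π d
    · rw [if_pos hda, if_pos hda, brick_eq, hda.2, C_1, mul_one]
    · rw [if_neg hda, if_neg hda, C_0, mul_zero, add_zero]

/-- **The total multi-peel member of 𝔄₁**: `D_spec = cpart · ∏_{γ ∈ Γ} (1 + x_{πγ} y_γ)`. -/
theorem map_multiPeelPoint_symbolicWitness (hc₀ : c₀ ∉ Γ) :
    MvPolynomial.map (eval (multiPeelPoint Γ π c₀ θ φ)) (symbolicWitness 1 h) = cpart θ φ c₀ * ∏ γ ∈ Γ, brick {π γ} {γ} := by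
  classical
  -- profile-1 anchors are the pairs of singletons
  let vx : Fin h × Fin h → Finset (Fin h) × Finset (Fin h) := fun q => ({q.1}, {q.2})
  have hvx : Function.Injective vx := fun q q' hqq => by
    have h1 := Finset.singleton_injective (congrArg Prod.fst hqq)
    have h2 := Finset.singleton_injective (congrArg Prod.snd hqq)
    exact Prod.ext h1 h2
  have hanch : anchors 1 h = (Finset.univ : Finset (Fin h × Fin h)).image vx := by
    ext α
    simp only [anchors, Finset.mem_filter, Finset.mem_univ, true_and, Finset.mem_image, vx]
    constructor
    · rintro ⟨h1, h2, h3, h4⟩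
      obtain ⟨a, ha⟩ := Finset.card_eq_one.mp (le_antisymm h2 h1)
      obtain ⟨d, hd⟩ := Finset.card_eq_one.mp (le_antisymm h4 h3)
      exact ⟨(a, d), Prod.ext ha.symm hd.symm⟩
    · rintro ⟨q, rfl⟩
      simp
  rw [symbolicWitness_eq_prod, map_prod, hanch, Finset.prod_image (fun q _ q' _ hqq => hvx hqq)]
  simp only [vx]
  rw [← Finset.univ_product_univ, Finset.prod_product_right]
  -- split the y-vertex d: d = c₀ gives cpart, d ∈ Γ gives the brick of (π d | d), others give 1
  have hcol : ∀ d : Fin h, ∏ a : Fin h, MvPolynomial.map (eval (multiPeelPoint Γ π c₀ θ φ)) (symbFactor h ({a}, {d})) =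
      if d = c₀ then cpart θ φ c₀ else if d ∈ Γ then brick {π d} {d} else 1 := by
    intro d
    simp_rw [map_multiPeelPoint_symbFactor Γ π c₀ θ φ hc₀]
    by_cases hd : d = c₀
    · simp_rw [if_pos hd]; rw [cpart]
    · simp_rw [if_neg hd]
      by_cases hdΓ : d ∈ Γ
      · rw [if_pos hdΓ, Finset.prod_eq_single (π d)]
        · rw [if_pos ⟨hdΓ, rfl⟩]
        · intro a _ ha; rw [if_neg (fun h' => ha h'.2)]
        · intro h'; exact absurd (Finset.mem_univ _) h'
      · rw [if_neg hdΓ]; exact Finset.prod_eq_one (fun a _ => by rw [if_neg (fun h' => hdΓ h'.1)])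
  simp_rw [hcol]
  rw [← Finset.mul_prod_erase Finset.univ _ (Finset.mem_univ c₀), if_pos rfl]
  congr 1
  have hΓsub : Γ ⊆ Finset.univ.erase c₀ := fun d hd =>
    Finset.mem_erase.mpr ⟨fun (hdc : d = c₀) => hc₀ (hdc ▸ hd), Finset.mem_univ _⟩
  rw [← Finset.prod_subset hΓsub (fun d hd hdΓ => by rw [if_neg (Finset.ne_of_mem_erase hd), if_neg hdΓ])]
  exact Finset.prod_congr rfl (fun d hd => by
    have hdc : d ≠ c₀ := fun hdc => hc₀ (hdc ▸ hd)
    rw [if_neg hdc, if_pos hd])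

/-! ## 4. The layout of the multi-peel member -/

/-- **Layout entries of the total multi-peel member.** For a column face `W ⊆ Γ ∪ {c₀}`:
`[x^U y^W] D_spec = [π(W∖c₀) ⊆ U] · ([c₀ ∈ W]·g(U ∖ π(W∖c₀)) + [c₀ ∉ W]·[U = πW])`. -/
theorem coeff_multiPeel (hc₀ : c₀ ∉ Γ) (U W : Finset (Fin h)) (hW : W ⊆ insert c₀ Γ) :
    coeff (pexpo U W) (cpart θ φ c₀ * ∏ γ ∈ Γ, brick {π γ} {γ}) =
      if (W.erase c₀).image π ⊆ U then
        (if c₀ ∈ W then doorCoeffX θ φ (U \ (W.erase c₀).image π) else (if U = W.image π then 1 else 0))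
      else 0 := by
  classical
  have hWΓ : Γ ∩ W = W.erase c₀ := by
    ext x
    simp only [Finset.mem_inter, Finset.mem_erase]
    constructor
    · rintro ⟨hxΓ, hxW⟩; exact ⟨fun hxc => hc₀ (hxc ▸ hxΓ), hxW⟩
    · rintro ⟨hxc, hxW⟩
      rcases Finset.mem_insert.mp (hW hxW) with hx | hx
      · exact absurd hx hxc
      · exact ⟨hx, hxW⟩
  rw [coeff_mul_prod_brick, hWΓ, Finset.sum_eq_single (W.erase c₀)]
  · by_cases hsub : (W.erase c₀).image π ⊆ U
    · rw [if_pos hsub, if_pos hsub, coeff_cpart]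
      by_cases hcW : c₀ ∈ W
      · have hT : W \ W.erase c₀ = {c₀} := by
          ext x; simp only [Finset.mem_sdiff, Finset.mem_erase, Finset.mem_singleton, not_and]
          exact ⟨fun hx => by_contra (fun hne => hx.2 hne hx.1), fun hx => ⟨hx ▸ hcW, fun hne => absurd hx hne⟩⟩
        rw [hT, if_neg (Finset.singleton_ne_empty _), if_pos rfl, if_pos hcW]
      · have hT : W \ W.erase c₀ = ∅ := by rw [Finset.erase_eq_of_notMem hcW, Finset.sdiff_self]
        rw [hT, if_pos rfl, if_neg hcW, Finset.erase_eq_of_notMem hcW]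
        rw [Finset.erase_eq_of_notMem hcW] at hsub
        by_cases hU : U = W.image π
        · rw [if_pos hU, if_pos (by rw [hU, Finset.sdiff_self])]
        · rw [if_neg hU, if_neg (fun h0 => hU (Finset.Subset.antisymm (Finset.sdiff_eq_empty_iff_subset.mp h0) hsub))]
    · rw [if_neg hsub, if_neg hsub]
  · intro S hS hne
    rw [coeff_cpart]
    have hSsub : S ⊆ W.erase c₀ := Finset.mem_powerset.mp hS
    -- `W \ S` contains a vertex of `Γ` (so it is neither `∅` nor `{c₀}`)
    obtain ⟨x, hx⟩ : ∃ x, x ∈ W.erase c₀ ∧ x ∉ S := by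
      by_contra hno; push Not at hno; exact hne (Finset.Subset.antisymm hSsub (fun x hx => hno x hx))
    have hxWS : x ∈ W \ S := Finset.mem_sdiff.mpr ⟨(Finset.mem_erase.mp hx.1).2, hx.2⟩
    have hxc : x ≠ c₀ := (Finset.mem_erase.mp hx.1).1
    have h1 : W \ S ≠ ∅ := Finset.ne_empty_of_mem hxWS
    have h2 : W \ S ≠ {c₀} := fun heq => hxc (Finset.mem_singleton.mp (heq ▸ hxWS))
    simp only [if_neg h1, if_neg h2, ite_self]
  · exact fun hne => absurd (Finset.mem_powerset.mpr subset_rfl) hne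

end Member

end

end Summit.ValiantsHypothesis.ValiantsHypothesis.Theorems.BarrierLever.AnchoredPeeling
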